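import Mathlib.Analysis.SpecialFunctions.Complex.Arg
import Mathlib.Algebra.Order.ToIntervalMod
import Mathlib.Probability.ConditionalProbability
import Mathlib.MeasureTheory.Integral.Bochner.Set
import Mathlib.Data.Set.Finite.Powerset
import Literature.Probability.Percolation.InterfaceScalingLimit
import Literature.Probability.LatticeModels.FermionicObservable
import HarnessLib

/-!
# Collar patterns, two-arm block events and the winding-twisted block kernel (bond-`ℤ²`, `p = ½`)

Topic `Probability/Percolation`; definition request `defn-TwistedArmBlockKernel` (route
`CriticalPhenomena/CardyFormulaZ2/CardyComplexCone`, card *complex-cone-winding-perron-frobenius*, D1),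
wanted to type the items `UniformConeCondition` / `MarkovBlockPresentation`. Setting: critical bond
percolation `bondPercolation (zdGraph 2) half` on `δℤ²` and the medial exploration interface ("hull")
`γ = fkInterface (dobrushinData D δ) ω : List MedialVertex` of a Dobrushin domain `D`, drawn through the
points `medialPoint δ e` (`MedialInterface`, `FermionicObservable`, `InterfaceScalingLimit`).

## Contents (namespace `Literature.Probability.Percolation`)

1. **Integer winding classes of polylines** (card P1, "telescoping tangent angles across the cuts").
   For a polyline `z₀ z₁ … zₙ` the turning at `zᵢ` is `turning zᵢ₋₁ zᵢ zᵢ₊₁ = arg((zᵢ₊₁-zᵢ)/(zᵢ-zᵢ₋₁))`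
   and `winding = Σ turning` (`FermionicObservable`). Since `arg (x/y) ≡ arg x - arg y (mod 2π)`,
   `turning zᵢ₋₁ zᵢ zᵢ₊₁ = (arg(zᵢ₊₁-zᵢ) - arg(zᵢ-zᵢ₋₁)) + 2π·nᵢ` with an INTEGER `nᵢ = turningClass … ∈ {-1,0,1}`
   (`turning_eq_arg_sub_arg_add`). Summing, the tangent angles telescope:
   `winding zs = (lastArg zs - headArg zs) + 2π·windingClass zs` (`winding_eq_lastArg_sub_headArg_add`),
   `windingClass zs = Σᵢ nᵢ ∈ ℤ`; and for any region `S ⊆ ℂ` the **block winding class**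
   `windingClassIn S zs := Σ_{zᵢ ∈ S} nᵢ ∈ ℤ` is additive over disjoint regions (`windingClassIn_union`,
   `windingClassIn_add_compl`). Within each maximal run ("piece") of consecutive vertices in `S` the
   same telescoping gives `Σ_{piece} turning = (θ_out - θ_in) + 2π·N_piece`, `θ_in/θ_out` the directions
   of the segments entering/leaving the piece: `N_piece` is determined by the piece and its end
   directions, and `exp(-i s·W)` of the whole curve is `exp(-i s(θ_end-θ_start))` times the product over
   blocks of `exp(-2πi s·N_block)` (`exp_neg_mul_winding_eq`; at `s = 1/3` the block factor is
   `cardyOmega ^ (-N_block)`, `cardyOmega = e^{2πi/3}`).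
2. **Collars and collar patterns.** `collarSites z r C δ` / `collarEdges z r C δ`: sites / lattice edges
   of `ℤ²` whose mesh-`δ` image lies in the open annulus `r - Cδ < |w - z| < r + Cδ` (finite:
   `collarEdges_finite`); `CollarPattern z r C δ := ↥(𝒫 collarEdges z r C δ)`, a `Fintype`, and
   `collarPattern z r C δ ω := ω ∩ collarEdges …` — the FULL collar configuration (request (a); the
   coarser "crossing data" — sectors, arm topology, crossing directions — are functions of it and of
   the hull, to be obtained by post-composition; measurable: `measurableSet_collarPattern_eq`).
3. **Hull events.** `hullReaches D δ z ρ`: `γ` has a medial vertex in the open disc `B(z, ρ)`;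
   `firstEntryIdx`/`hullPrefix … ρ`: `γ` up to and including its first entrance into `B(z, ρ)`;
   `armPatternEvent D δ z r C ξ := {collarPattern = ξ} ∩ hullReaches D δ z r` ("outer pattern `ξ`,
   two-arm compatible": for `z` at distance `> r` from `∂D` the chordal interface reaching `B(z,r)` is
   the two-arm event — one primal, one dual arm — from `∂B(z,r)` to `∂D`); the **two-arm block event**
   (request (b)) `twoArmBlockEvent D δ z r ρ C ξ η := armPatternEvent … r … ξ ∩ armPatternEvent … ρ … η`.
   BLOCKS ARE INDEXED BY THEIR TWO RADII `r` (outer) and `ρ` (inner) — for block ratio `b` take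
   `ρ = r/b` — so that kernels of consecutive blocks `(r₀,r₁), (r₁,r₂), …` compose without casts
   (the inner pattern type `CollarPattern z r₁ C δ` of one is the outer pattern type of the next).
4. **The winding increment of a block** (request (c)): `blockWindingClass D δ z r ρ ω :=
   windingClassIn (blockAnnulus z ρ r) (hullPrefix γ δ z ρ ↦ medialPoint δ)` — the integer winding
   class `N_b` accumulated at the vertices of the hull lying in the half-open annulus `ρ ≤ |w - z| < r`,
   the hull being run until its first entrance into the inner disc `B(z, ρ)`.
5. **The kernels** (request (d)), under `μ = bondPercolation (zdGraph 2) half` conditioned (Mathlib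
   `ProbabilityTheory.cond`, `μ[|F]`) on `F = armPatternEvent D δ z r C ξ`:
   `twistedArmBlockKernel D δ z r ρ C ξ η := ∫ ω in armPatternEvent … ρ … η, cardyOmega ^ N_b ∂μ[|F]`
   (`a_b(ξ,η) = E[ω^{N_b}·1_η | ξ]`, a complex matrix indexed by outer × inner patterns) and its
   untwisted companion `armBlockKernel … ξ η := μ[armPatternEvent … ρ … η | F]` (`P(η | ξ)`, the
   sub-Markov arm-transition kernel); `‖a_b(ξ,η)‖ ≤ P(η|ξ) ≤ 1`
   (`norm_twistedArmBlockKernel_le`, `armBlockKernel_le_one`).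

## Design choices, junk values, what is NOT here

* The objects of §§3–5 are NEW (posited by the route); only their ingredients are classical: arm
  events of annuli with prescribed landing data (Nolin 2008, §4.1 `A_{j,σ}(n,N)` and §4.2 Def. 8,
  landing sequences; Kesten 1987), conditioning an arm event on the configuration seen from outside
  (Kesten 1986, the incipient infinite cluster), the winding of the exploration path (Smirnov 2010,
  §2.2). They are tagged `[folklore]` with this paragraph as provenance; nothing printed is asserted.
* TIME CONVENTION for `N_b` and for "reaches": the hull is the chordal interface run from its start
  `e_a`; `blockWindingClass` only counts turning before the FIRST entrance into `B(z, ρ)` (later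
  re-entries of the block are not charged to it), and the block is half-open so that the blocks of
  radii `r₀ > r₁ > … > r_J` partition `B(z,r₀) ∖ B(z,r_J)` and `windingClassIn` adds up over them
  exactly (`windingClassIn_union`, `windingClassIn_ball_eq_add`). Other conventions (whole interface,
  prefix up to a passage at `z`, time windows between first entrances) are one-liners in
  `windingClassIn`/`windingClass` applied to other sublists of `γ`; the route items fix theirs.
* `arg 0 = 0`: repeated consecutive points give junk turning classes; the factorisation theorems assume
  `List.IsChain (· ≠ ·)`. `headArg`/`lastArg` are `0` on lists with `< 2` points. `ProbabilityTheory.cond`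
  is the zero measure when `μ F = 0`, so both kernels vanish on unreachable outer patterns (e.g. a
  fully open collar); Dubois-type strict inequalities must therefore be restricted to patterns of
  positive mass, as the route intends ("good sub-cone"). Blocks are meaningful for `0 < ρ < r`.
* Measurability of `hullReaches` (hence of the kernels' events) depends on that of `fkInterface`,
  assumed/known but not proved in `MedialInterface` (outline §0); the pattern events are proved
  measurable here. No Markov property, no quasi-multiplicativity and no estimate is asserted.

## References

* P. Nolin, *Near-critical percolation in two dimensions*, EJP 13 (2008), §4.1–4.2, Def. 8 [Nolin2008].
* H. Kesten, *The incipient infinite cluster in two-dimensional percolation*, PTRF 73 (1986) [Kesten1986].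
* H. Kesten, *Scaling relations for 2D-percolation*, CMP 109 (1987), §1 [Kesten1987Scaling].
* S. Smirnov, *Conformal invariance in random cluster models. I*, Ann. Math. 172 (2010), §2.2 [Smirnov2010].
* L. Dubois, *Projective metrics and contraction principles for complex cones*, JLMS 79 (2009) [Dubois2009].
-/

noncomputable section

open MeasureTheory Complex
open scoped Real ProbabilityTheory

namespace Literature.Probability.Percolation

open Literature.Probability.LatticeModels
open Literature.Probability.RandomPlanarGeometry (DobrushinDomain)

/-! ### 1. Integer winding classes of polylines -/

/-- The **turning class** at `z₂` of the polyline `z₁ → z₂ → z₃`: the integer `n ∈ {-1, 0, 1}` with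
`turning z₁ z₂ z₃ = arg (z₃ - z₂) - arg (z₂ - z₁) + 2π n` (`turning_eq_arg_sub_arg_add`), i.e. the
signed number of times the tangent direction crosses the branch cut of `arg` at this vertex;
`-toIocDiv` of the angle difference reduced to `(-π, π]`. [folklore] -/
def turningClass (z₁ z₂ z₃ : ℂ) : ℤ :=
  -toIocDiv Real.two_pi_pos (-π) (arg (z₃ - z₂) - arg (z₂ - z₁))

/-- **Telescoping of tangent angles at one vertex**: for non-degenerate segments,
`turning z₁ z₂ z₃ = (arg (z₃ - z₂) - arg (z₂ - z₁)) + 2π · turningClass z₁ z₂ z₃`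
(`arg (x / y) ≡ arg x - arg y (mod 2π)`, Mathlib `Complex.arg_div_coe_angle`). [folklore] -/
theorem turning_eq_arg_sub_arg_add {z₁ z₂ z₃ : ℂ} (h₁₂ : z₁ ≠ z₂) (h₂₃ : z₂ ≠ z₃) :
    turning z₁ z₂ z₃ = arg (z₃ - z₂) - arg (z₂ - z₁) + 2 * π * turningClass z₁ z₂ z₃ := by
  have hx : z₃ - z₂ ≠ 0 := sub_ne_zero.2 h₂₃.symm
  have hy : z₂ - z₁ ≠ 0 := sub_ne_zero.2 h₁₂.symm
  have key : arg ((z₃ - z₂) / (z₂ - z₁)) =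
      toIocMod Real.two_pi_pos (-π) (arg (z₃ - z₂) - arg (z₂ - z₁)) := by
    rw [← Real.Angle.toReal_coe, Real.Angle.coe_sub, ← arg_div_coe_angle hx hy,
      arg_coe_angle_toReal_eq_arg]
  show arg ((z₃ - z₂) / (z₂ - z₁)) = _
  rw [key, turningClass, ← self_sub_toIocDiv_zsmul, zsmul_eq_mul]
  push_cast
  ring

/-- The **integer winding class** of a polyline: the sum of the turning classes at its interior
vertices, so that `winding zs = lastArg zs - headArg zs + 2π · windingClass zs`
(`winding_eq_lastArg_sub_headArg_add`). `0` for fewer than three points. [folklore] -/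
def windingClass : List ℂ → ℤ
  | z₁ :: z₂ :: z₃ :: zs => turningClass z₁ z₂ z₃ + windingClass (z₂ :: z₃ :: zs)
  | _ => 0

open scoped Classical in
/-- The **block winding class** of a polyline relative to a region `S ⊆ ℂ`: the sum of the turning
classes at those interior vertices that lie in `S` (card P1: the integer winding increment of the
pieces of the curve inside the block, boundary phases removed by telescoping). [folklore] -/
def windingClassIn (S : Set ℂ) : List ℂ → ℤ
  | z₁ :: z₂ :: z₃ :: zs =>
      (if z₂ ∈ S then turningClass z₁ z₂ z₃ else 0) + windingClassIn S (z₂ :: z₃ :: zs)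
  | _ => 0

/-- The direction (argument of the increment) of the first segment of a polyline; junk `0` for fewer
than two points. [folklore] -/
def headArg : List ℂ → ℝ
  | z₁ :: z₂ :: _ => arg (z₂ - z₁)
  | _ => 0

/-- The direction (argument of the increment) of the last segment of a polyline; junk `0` for fewer
than two points. [folklore] -/
def lastArg : List ℂ → ℝ
  | _ :: z₂ :: z₃ :: zs => lastArg (z₂ :: z₃ :: zs)
  | [z₁, z₂] => arg (z₂ - z₁)
  | _ => 0

/-- Recursion step of `windingClass`. [folklore] -/
@[simp] theorem windingClass_cons_cons_cons (z₁ z₂ z₃ : ℂ) (zs : List ℂ) :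
    windingClass (z₁ :: z₂ :: z₃ :: zs) = turningClass z₁ z₂ z₃ + windingClass (z₂ :: z₃ :: zs) := rfl

open scoped Classical in
/-- Recursion step of `windingClassIn`. [folklore] -/
@[simp] theorem windingClassIn_cons_cons_cons (S : Set ℂ) (z₁ z₂ z₃ : ℂ) (zs : List ℂ) :
    windingClassIn S (z₁ :: z₂ :: z₃ :: zs) =
      (if z₂ ∈ S then turningClass z₁ z₂ z₃ else 0) + windingClassIn S (z₂ :: z₃ :: zs) := rfl

/-- **Additivity over disjoint regions**: the block winding classes of two disjoint regions add up to
that of their union (so `N` of a ball is the sum over the nested annulus blocks partitioning it). [folklore] -/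
theorem windingClassIn_union {S T : Set ℂ} (hST : Disjoint S T) :
    ∀ zs : List ℂ, windingClassIn (S ∪ T) zs = windingClassIn S zs + windingClassIn T zs
  | z₁ :: z₂ :: z₃ :: zs => by
    rw [windingClassIn_cons_cons_cons, windingClassIn_cons_cons_cons, windingClassIn_cons_cons_cons,
      windingClassIn_union hST (z₂ :: z₃ :: zs)]
    by_cases hS : z₂ ∈ S
    · have hT : z₂ ∉ T := Set.disjoint_left.1 hST hS
      rw [if_pos (Set.mem_union_left T hS), if_pos hS, if_neg hT]; ring
    · by_cases hT : z₂ ∈ T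
      · rw [if_pos (Set.mem_union_right S hT), if_neg hS, if_pos hT]; ring
      · have hU : z₂ ∉ S ∪ T := fun h => by rcases h with h | h; exacts [hS h, hT h]
        rw [if_neg hU, if_neg hS, if_neg hT]; ring
  | [] => by simp [windingClassIn]
  | [_] => by simp [windingClassIn]
  | [_, _] => by simp [windingClassIn]

/-- Over the whole plane the block winding class is the winding class. [folklore] -/
@[simp] theorem windingClassIn_univ : ∀ zs : List ℂ, windingClassIn Set.univ zs = windingClass zs
  | z₁ :: z₂ :: z₃ :: zs => by
    rw [windingClassIn_cons_cons_cons, windingClass_cons_cons_cons, windingClassIn_univ (z₂ :: z₃ :: zs),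
      if_pos (Set.mem_univ _)]
  | [] => rfl
  | [_] => rfl
  | [_, _] => rfl

/-- A region and its complement split the winding class: `N = N_S + N_{Sᶜ}`. [folklore] -/
theorem windingClassIn_add_compl (S : Set ℂ) (zs : List ℂ) :
    windingClassIn S zs + windingClassIn Sᶜ zs = windingClass zs := by
  rw [← windingClassIn_union disjoint_compl_right, Set.union_compl_self, windingClassIn_univ]

/-- **Telescoping of tangent angles along a polyline** (card P1): if consecutive points are distinct,
`winding zs = (lastArg zs - headArg zs) + 2π · windingClass zs` — the winding is the net rotation from
the first to the last segment direction plus `2π` times an integer. [folklore] -/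
theorem winding_eq_lastArg_sub_headArg_add :
    ∀ zs : List ℂ, zs.IsChain (· ≠ ·) →
      winding zs = lastArg zs - headArg zs + 2 * π * windingClass zs
  | z₁ :: z₂ :: z₃ :: zs, h => by
    rw [List.isChain_cons_cons] at h
    have h' := h.2
    have h₂₃ : z₂ ≠ z₃ := (List.isChain_cons_cons.1 h').1
    rw [winding_cons_cons_cons, winding_eq_lastArg_sub_headArg_add _ h',
      turning_eq_arg_sub_arg_add h.1 h₂₃, windingClass_cons_cons_cons]
    simp only [lastArg, headArg]
    push_cast
    ring
  | [], _ => by simp [lastArg, headArg, windingClass]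
  | [_], _ => by simp [lastArg, headArg, windingClass]
  | [_, _], _ => by simp [lastArg, headArg, windingClass]

/-- **Factorisation of the winding phase** (card P1, "`exp(-(i/3)·W)` factorises over blocks"): for a
polyline with distinct consecutive points and any spin `s`,
`exp(-i s W) = exp(-i s (θ_end - θ_start)) · exp(-2π i s · N)`, `N = windingClass zs`; combine with
`windingClassIn_add_compl`/`windingClassIn_union` to split `N` over blocks. [folklore] -/
theorem exp_neg_mul_winding_eq {zs : List ℂ} (h : zs.IsChain (· ≠ ·)) (s : ℝ) :
    exp (-(I * s) * (winding zs : ℝ)) =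
      exp (-(I * s) * ((lastArg zs - headArg zs : ℝ) : ℂ)) *
        exp (-(2 * π * I * s) * (windingClass zs : ℂ)) := by
  rw [← Complex.exp_add, winding_eq_lastArg_sub_headArg_add zs h]
  push_cast
  ring_nf

/-- `ω = e^{2πi/3}`, the cube root of unity of the spin-`1/3` twist (`exp(-(i/3)·2πN) = ω^{-N}`). [folklore] -/
def cardyOmega : ℂ := exp (↑(2 * π / 3) * I)

/-- `‖ω‖ = 1`. [folklore] -/
@[simp] theorem norm_cardyOmega : ‖cardyOmega‖ = 1 := norm_exp_ofReal_mul_I _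

/-- `ω ^ 3 = 1`. [folklore] -/
theorem cardyOmega_pow_three : cardyOmega ^ 3 = 1 := by
  rw [cardyOmega, ← Complex.exp_nat_mul]
  convert Complex.exp_two_pi_mul_I using 2
  push_cast
  ring

/-- `‖ω ^ N‖ = 1` for every integer `N`. [folklore] -/
@[simp] theorem norm_cardyOmega_zpow (N : ℤ) : ‖cardyOmega ^ N‖ = 1 := by
  rw [norm_zpow, norm_cardyOmega, one_zpow]

/-- At spin `1/3` the integer part of the winding phase is a power of `ω̄ = ω⁻¹`:
`exp(-(2πi/3)·N) = cardyOmega ^ (-N)`. [folklore] -/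
theorem exp_neg_two_pi_div_three_mul (N : ℤ) :
    exp (-(2 * π * I * (1 / 3 : ℝ)) * (N : ℂ)) = cardyOmega ^ (-N) := by
  rw [cardyOmega, ← Complex.exp_int_mul]
  congr 1
  push_cast
  ring

/-! ### 2. Collars and collar patterns -/

/-- The **collar sites** at radius `r` about `z` (half-width `C` lattice units, mesh `δ`): sites of
`ℤ²` whose mesh point lies in the open annulus `r - Cδ < |w - z| < r + Cδ`. [folklore] -/
def collarSites (z : ℂ) (r C δ : ℝ) : Set (Site 2) :=
  {x | r - C * δ < dist (meshPoint δ x) z ∧ dist (meshPoint δ x) z < r + C * δ}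

/-- The **collar edges**: lattice edges (= medial vertices) with both endpoints in the collar. [folklore] -/
def collarEdges (z : ℂ) (r C δ : ℝ) : Set MedialVertex :=
  {e | e ∈ (zdGraph 2).edgeSet ∧ ∀ x ∈ e, x ∈ collarSites z r C δ}

/-- The collar is a finite set of sites (empty at the junk mesh `δ = 0`). [folklore] -/
theorem collarSites_finite (z : ℂ) (r C δ : ℝ) : (collarSites z r C δ).Finite := by
  rcases eq_or_ne δ 0 with rfl | hδ
  · refine Set.finite_empty.subset ?_
    rintro x ⟨h1, h2⟩
    simp only [meshPoint, Complex.ofReal_zero, zero_mul, mul_zero, sub_zero, add_zero] at h1 h2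
    exact (lt_irrefl _ (h1.trans h2)).elim
  · set R : ℝ := ‖z‖ + |r + C * δ|
    have hδ' : 0 < |δ| := abs_pos.2 hδ
    refine (Set.Finite.pi (t := fun _ : Fin 2 => Set.Icc (⌊-(R / |δ|)⌋) (⌈R / |δ|⌉))
      fun _ => Set.finite_Icc _ _).subset ?_
    intro x hx
    have hn : ‖meshPoint δ x‖ ≤ R := by
      have h1 := norm_sub_norm_le (meshPoint δ x) z
      have h2 : ‖meshPoint δ x - z‖ < r + C * δ := by rw [← dist_eq_norm]; exact hx.2
      have h3 := le_abs_self (r + C * δ)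
      simp only [R]; linarith
    have key : ∀ a : ℤ, |δ| * |(a : ℝ)| ≤ R → a ∈ Set.Icc (⌊-(R / |δ|)⌋) (⌈R / |δ|⌉) := fun a ha => by
      have ha' : |(a : ℝ)| ≤ R / |δ| := by rwa [le_div_iff₀ hδ', mul_comm]
      obtain ⟨h1, h2⟩ := abs_le.1 ha'
      exact ⟨Int.cast_le.1 ((Int.floor_le _).trans h1), Int.cast_le.1 (h2.trans (Int.le_ceil _))⟩
    have hre := (abs_re_le_norm _).trans hn
    have him := (abs_im_le_norm _).trans hn
    rw [meshPoint_re, abs_mul] at hre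
    rw [meshPoint_im, abs_mul] at him
    simp only [Set.mem_pi, Set.mem_univ, forall_true_left, Fin.forall_fin_two]
    exact ⟨key _ hre, key _ him⟩

/-- There are finitely many collar edges. [folklore] -/
theorem collarEdges_finite (z : ℂ) (r C δ : ℝ) : (collarEdges z r C δ).Finite := by
  refine (((collarSites_finite z r C δ).prod (collarSites_finite z r C δ)).image
    fun p : Site 2 × Site 2 => s(p.1, p.2)).subset ?_
  intro e he
  induction e using Sym2.ind with
  | h a b =>
    exact ⟨(a, b), ⟨he.2 a (Sym2.mem_mk_left a b), he.2 b (Sym2.mem_mk_right a b)⟩, rfl⟩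

/-- The finite type of **collar patterns** at radius `r` about `z`: sub-configurations of the collar
edge set (request (a): "the restriction of the bond configuration to the lattice annulus of radii
`(r - Cδ, r + Cδ)` about `z`, as a finite type depending on `(z, r, δ)`"). [folklore] -/
abbrev CollarPattern (z : ℂ) (r C δ : ℝ) : Type := ↥(𝒫 collarEdges z r C δ)

/-- Collar patterns form a finite type. [folklore] -/
instance instFintypeCollarPattern (z : ℂ) (r C δ : ℝ) : Fintype (CollarPattern z r C δ) :=
  (collarEdges_finite z r C δ).powerset.fintype

/-- The **collar pattern** of a bond configuration: its restriction `ω ∩ collarEdges z r C δ` to the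
collar edges, as an element of the finite pattern type. [folklore] -/
def collarPattern (z : ℂ) (r C δ : ℝ) (ω : BondConfig (Site 2)) : CollarPattern z r C δ :=
  ⟨ω ∩ collarEdges z r C δ, Set.inter_subset_right⟩

/-- The underlying edge set of `collarPattern`. [folklore] -/
@[simp] theorem coe_collarPattern (z : ℂ) (r C δ : ℝ) (ω : BondConfig (Site 2)) :
    ((collarPattern z r C δ ω : CollarPattern z r C δ) : Set MedialVertex) = ω ∩ collarEdges z r C δ := rfl

/-- Every collar pattern is realised (by itself, as a configuration). [folklore] -/
theorem collarPattern_surjective (z : ℂ) (r C δ : ℝ) : Function.Surjective (collarPattern z r C δ) :=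
  fun ξ => ⟨ξ.1, Subtype.ext (Set.inter_eq_left.2 ξ.2)⟩

/-- Pattern events are cylinder events, hence measurable. [folklore] -/
theorem measurableSet_collarPattern_eq (z : ℂ) (r C δ : ℝ) (ξ : CollarPattern z r C δ) :
    MeasurableSet {ω : BondConfig (Site 2) | collarPattern z r C δ ω = ξ} := by
  have hm : Measurable fun ω : BondConfig (Site 2) => ω ∩ collarEdges z r C δ :=
    measurable_set_iff.2 fun a => (measurable_set_mem a).and measurable_const
  have : {ω : BondConfig (Site 2) | collarPattern z r C δ ω = ξ} =
      (fun ω : BondConfig (Site 2) => ω ∩ collarEdges z r C δ) ⁻¹' {ξ.1} := by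
    ext ω
    simp only [Set.mem_setOf_eq, Set.mem_preimage, Set.mem_singleton_iff, collarPattern]
    exact ⟨fun h => congrArg Subtype.val h, fun h => Subtype.ext h⟩
  rw [this]
  exact hm (measurableSet_singleton _)

/-! ### 3. Hull events and the two-arm block event -/

/-- The index of the first medial vertex of the path `γ` whose point at mesh `δ` lies in the open
disc `B(z, ρ)`; `γ.length` if there is none. [folklore] -/
def firstEntryIdx (γ : List MedialVertex) (δ : ℝ) (z : ℂ) (ρ : ℝ) : ℕ :=
  γ.findIdx fun e => decide (dist (medialPoint δ e) z < ρ)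

/-- The **hull prefix**: `γ` up to and including its first entrance into `B(z, ρ)` (all of `γ` if it
never enters). [folklore] -/
def hullPrefix (γ : List MedialVertex) (δ : ℝ) (z : ℂ) (ρ : ℝ) : List MedialVertex :=
  γ.take (firstEntryIdx γ δ z ρ + 1)

/-- The event that the exploration hull `fkInterface (dobrushinData D δ) ω` **reaches** the open disc
`B(z, ρ)`: one of its medial vertices is drawn inside. For `dist(z, ∂D) > ρ` this is the two-arm
event (one primal, one dual arm) from `∂B(z, ρ)` to `∂D`. [folklore] -/
def hullReaches (D : DobrushinDomain) (δ : ℝ) (z : ℂ) (ρ : ℝ) : Set (BondConfig (Site 2)) :=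
  {ω | ∃ e ∈ fkInterface (dobrushinData D δ) ω, dist (medialPoint δ e) z < ρ}

/-- Reaching a smaller disc implies reaching a larger one. [folklore] -/
theorem hullReaches_mono (D : DobrushinDomain) (δ : ℝ) (z : ℂ) {ρ ρ' : ℝ} (h : ρ ≤ ρ') :
    hullReaches D δ z ρ ⊆ hullReaches D δ z ρ' :=
  fun _ ⟨e, he, hd⟩ => ⟨e, he, hd.trans_le h⟩

/-- The **arm-pattern event** at radius `r`: the hull reaches `B(z, r)` and the collar pattern at
radius `r` is `ξ` ("outer pattern `ξ`, two-arm compatible"). [folklore] -/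
def armPatternEvent (D : DobrushinDomain) (δ : ℝ) (z : ℂ) (r C : ℝ) (ξ : CollarPattern z r C δ) :
    Set (BondConfig (Site 2)) :=
  {ω | collarPattern z r C δ ω = ξ} ∩ hullReaches D δ z r

/-- The **two-arm block event** of the block with outer radius `r` and inner radius `ρ` (`ρ = r/b`
for block ratio `b`; request (b)): the hull crosses the annulus down to `B(z, ρ)` showing the outer
pattern `ξ` at radius `r` and the inner pattern `η` at radius `ρ`. [folklore] -/
def twoArmBlockEvent (D : DobrushinDomain) (δ : ℝ) (z : ℂ) (r ρ C : ℝ) (ξ : CollarPattern z r C δ)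
    (η : CollarPattern z ρ C δ) : Set (BondConfig (Site 2)) :=
  armPatternEvent D δ z r C ξ ∩ armPatternEvent D δ z ρ C η

/-- On the block event the hull reaches the inner disc. [folklore] -/
theorem twoArmBlockEvent_subset_hullReaches (D : DobrushinDomain) (δ : ℝ) (z : ℂ) (r ρ C : ℝ)
    (ξ : CollarPattern z r C δ) (η : CollarPattern z ρ C δ) :
    twoArmBlockEvent D δ z r ρ C ξ η ⊆ hullReaches D δ z ρ :=
  fun _ h => h.2.2

/-! ### 4. The winding increment of a block -/

/-- The half-open **block annulus** `{w | ρ ≤ |w - z| < r}`; blocks of radii `r₀ > r₁ > …` partition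
a punctured disc. [folklore] -/
def blockAnnulus (z : ℂ) (ρ r : ℝ) : Set ℂ := {w | ρ ≤ dist w z ∧ dist w z < r}

/-- A disc splits into a smaller disc and the block annulus between them. [folklore] -/
theorem ball_eq_ball_union_blockAnnulus (z : ℂ) {ρ r : ℝ} (h : ρ ≤ r) :
    Metric.ball z r = Metric.ball z ρ ∪ blockAnnulus z ρ r := by
  ext w
  simp only [Metric.mem_ball, Set.mem_union, blockAnnulus, Set.mem_setOf_eq]
  constructor
  · intro hw; rcases lt_or_ge (dist w z) ρ with h' | h' <;> simp [h', hw]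
  · rintro (hw | ⟨-, hw⟩) <;> linarith

/-- **`N_b`** (request (c)): the integer winding class accumulated by the hull, run until its first
entrance into the inner disc `B(z, ρ)`, at its vertices inside the block annulus `ρ ≤ |w - z| < r`
(`ρ = r/b` for block ratio `b`). [folklore] -/
def blockWindingClass (D : DobrushinDomain) (δ : ℝ) (z : ℂ) (r ρ : ℝ) (ω : BondConfig (Site 2)) : ℤ :=
  windingClassIn (blockAnnulus z ρ r)
    ((hullPrefix (fkInterface (dobrushinData D δ) ω) δ z ρ).map (medialPoint δ))

/-- `N` of the hull prefix over a disc splits over the inner disc and the block (nested-block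
additivity, from `windingClassIn_union`). [folklore] -/
theorem windingClassIn_ball_eq_add (z : ℂ) {ρ r : ℝ} (h : ρ ≤ r) (zs : List ℂ) :
    windingClassIn (Metric.ball z r) zs =
      windingClassIn (Metric.ball z ρ) zs + windingClassIn (blockAnnulus z ρ r) zs := by
  rw [ball_eq_ball_union_blockAnnulus z h]
  exact windingClassIn_union (Set.disjoint_left.2 fun w (hw : w ∈ Metric.ball z ρ)
    (hw' : w ∈ blockAnnulus z ρ r) => (not_le.2 (Metric.mem_ball.1 hw)) hw'.1) zs

/-! ### 5. The twisted and untwisted block kernels -/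

/-- The **winding-twisted two-arm block kernel** (request (d)):
`a_b(ξ, η) = E[ω^{N_b} · 1_{inner pattern = η, hull reaches B(z,ρ)} | outer pattern = ξ, hull reaches B(z,r)]`
for the block with outer radius `r` and inner radius `ρ` (`ρ = r/b` for block ratio `b`), under
`bondPercolation (zdGraph 2) half`, `ω = cardyOmega = e^{2πi/3}`, `N_b = blockWindingClass D δ z r ρ`.
As a function of `(ξ, η)` this is literally a `Matrix (CollarPattern z r C δ) (CollarPattern z ρ C δ) ℂ`
(reindex by `Fintype.equivFin` to feed `Fin`-indexed matrix statements); kernels of consecutive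
blocks `(r₀,r₁), (r₁,r₂), …` compose as they stand. Zero on outer patterns of probability `0`. [folklore] -/
def twistedArmBlockKernel (D : DobrushinDomain) (δ : ℝ) (z : ℂ) (r ρ C : ℝ) (ξ : CollarPattern z r C δ)
    (η : CollarPattern z ρ C δ) : ℂ :=
  ∫ ω in armPatternEvent D δ z ρ C η, cardyOmega ^ blockWindingClass D δ z r ρ ω
    ∂(bondPercolation (zdGraph 2) half)[|armPatternEvent D δ z r C ξ]

/-- The **untwisted companion** `P(η | ξ)`: the conditional probability, given outer pattern `ξ` and
the hull reaching `B(z, r)`, that it reaches `B(z, ρ)` with inner pattern `η` (the sub-Markov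
arm-transition kernel between the scales `r` and `ρ = r/b`). [folklore] -/
def armBlockKernel (D : DobrushinDomain) (δ : ℝ) (z : ℂ) (r ρ C : ℝ) (ξ : CollarPattern z r C δ)
    (η : CollarPattern z ρ C δ) : ℝ :=
  ((bondPercolation (zdGraph 2) half)[|armPatternEvent D δ z r C ξ]).real (armPatternEvent D δ z ρ C η)

/-- `0 ≤ P(η | ξ)`. [folklore] -/
theorem armBlockKernel_nonneg (D : DobrushinDomain) (δ : ℝ) (z : ℂ) (r ρ C : ℝ)
    (ξ : CollarPattern z r C δ) (η : CollarPattern z ρ C δ) : 0 ≤ armBlockKernel D δ z r ρ C ξ η :=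
  measureReal_nonneg

/-- `P(η | ξ) ≤ 1` (the conditional measure is zero or a probability measure). [folklore] -/
theorem armBlockKernel_le_one (D : DobrushinDomain) (δ : ℝ) (z : ℂ) (r ρ C : ℝ)
    (ξ : CollarPattern z r C δ) (η : CollarPattern z ρ C δ) : armBlockKernel D δ z r ρ C ξ η ≤ 1 :=
  measureReal_le_one

/-- `P(η | ξ) = P(two-arm block event) / P(outer arm-pattern event)` as soon as the inner event is
measurable (Mathlib `ProbabilityTheory.cond_apply'`; `x / 0 = 0`). [folklore] -/
theorem armBlockKernel_eq_div (D : DobrushinDomain) (δ : ℝ) (z : ℂ) (r ρ C : ℝ)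
    (ξ : CollarPattern z r C δ) (η : CollarPattern z ρ C δ)
    (hη : MeasurableSet (armPatternEvent D δ z ρ C η)) :
    armBlockKernel D δ z r ρ C ξ η =
      (bondPercolation (zdGraph 2) half).real (twoArmBlockEvent D δ z r ρ C ξ η) /
        (bondPercolation (zdGraph 2) half).real (armPatternEvent D δ z r C ξ) := by
  rw [armBlockKernel, measureReal_def, ProbabilityTheory.cond_apply' hη, ENNReal.toReal_mul,
    ENNReal.toReal_inv, twoArmBlockEvent, measureReal_def, measureReal_def]
  exact inv_mul_eq_div _ _

/-- **Domination of the twisted kernel by the untwisted one**: `‖a_b(ξ, η)‖ ≤ P(η | ξ)` since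
`‖ω^{N_b}‖ = 1`. [folklore] -/
theorem norm_twistedArmBlockKernel_le (D : DobrushinDomain) (δ : ℝ) (z : ℂ) (r ρ C : ℝ)
    (ξ : CollarPattern z r C δ) (η : CollarPattern z ρ C δ) :
    ‖twistedArmBlockKernel D δ z r ρ C ξ η‖ ≤ armBlockKernel D δ z r ρ C ξ η := by
  have h := norm_setIntegral_le_of_norm_le_const (C := 1) (measure_lt_top _ _)
    (f := fun ω => cardyOmega ^ blockWindingClass D δ z r ρ ω)
    (μ := (bondPercolation (zdGraph 2) half)[|armPatternEvent D δ z r C ξ])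
    (s := armPatternEvent D δ z ρ C η) fun ω _ => (norm_cardyOmega_zpow _).le
  simpa [twistedArmBlockKernel, armBlockKernel] using h

/-- For block ratio `b`, the kernel "between radii `r` and `r/b`" of the request is the instance
`ρ = r / b`; consecutive dyadic-type blocks `r, r/b, r/b², …` are fed in as explicit radii. [folklore] -/
theorem twistedArmBlockKernel_ratio (D : DobrushinDomain) (δ : ℝ) (z : ℂ) (r b C : ℝ)
    (ξ : CollarPattern z r C δ) (η : CollarPattern z (r / b) C δ) :
    twistedArmBlockKernel D δ z r (r / b) C ξ η =
      ∫ ω in armPatternEvent D δ z (r / b) C η, cardyOmega ^ blockWindingClass D δ z r (r / b) ω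
        ∂(bondPercolation (zdGraph 2) half)[|armPatternEvent D δ z r C ξ] := rfl

end Literature.Probability.Percolation

end
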